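/-
Copyright (c) 2026. Released under Apache 2.0 license.

# CDT Theorem 1.0.1, holonomic side: the generators `F/Δᵐ` feed the dimension bound

For a finite-index subgroup `G ≤ SL(2, ℤ)` containing every conjugate of `T^{2N}` and a modular
form `F ∈ M_{12m}(G)`, the function `h := (λ/16)^{2m} · F/Δᵐ` is holomorphic on `ℍ`, invariant
under `G ⊓ Γ(2)`, and bounded at `i∞` after every translate by `SL(2, ℤ)`.  Consequently
(`exists_taylor_subst_eq_modFun`) the continuation theorem
`Literature.Analysis.Complex.exists_taylor_subst_eq_of_invariant_subgroup` applies to `h`: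
a formal identity `f(x) = 𝓣h` (Taylor series in the local parameter `q_{2N} = e^{πiτ/N}`,
rewritten through the formal root `x` of `x^N = Λ₁₆(q^N)`) algebraizes along any holomorphic
universal covering `Φ : D → ℂ ∖ μ_N` based at `0`, which is hypothesis `han` of
`CalegariDimitrovTang2025_unboundedDenominators.dim_le_unconditional`.
This is the analytic content of [CalegariDimitrovTang2025, Remark 3.0.2 and §6.3, proof of
Theorem 1.0.1 ("holonomic" bound (6.3.1))].
-/
import Literature.Analysis.Complex.RootsOfUnityComplementInvariantSubgroup
import Literature.NumberTheory.Automorphic.UnboundedDenominatorsFields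
import Literature.NumberTheory.Automorphic.ModularLambdaGammaTwo
import HarnessLib

open Complex Real Filter Topology Function Metric Set Asymptotics
open UpperHalfPlane hiding I
open scoped Real Topology Manifold MatrixGroups ModularForm

namespace Literature.NumberTheory.Automorphic

namespace UnboundedDenominators

open _root_.Complex Literature.NumberTheory.Automorphic.ModularLambda ModularGroup
  CongruenceSubgroup Matrix.SpecialLinearGroup Literature.Analysis.Complex

/-! ### `λ/16 = O(e^{-π Im τ})` at `i∞` -/

/-- **Rate of decay of `λ` at the cusp**: `λ(τ)/16 = O(e^{-π Im τ})` as `Im τ → ∞`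
(`λ = 16 q^{1/2} + O(q)`, `q = e^{2πiτ}`).  Proof: `λ/16 = Λ₁₆(e^{πiτ})` with `Λ₁₆` holomorphic on
the unit disc and `Λ₁₆(0) = 0`. [cite: CalegariDimitrovTang2025, §5.3 (5.3.1)] -/
theorem isBigO_modularLambda_div_sixteen_exp :
    (fun τ : ℍ ↦ modularLambda τ / 16) =O[atImInfty] fun τ : ℍ ↦ Real.exp (-π * τ.im) := by
  set Λ := cuspFunction 2 (fun τ : ℍ ↦ modularLambda τ / 16) with hΛdef
  have hd : DifferentiableOn ℂ Λ (ball 0 1) := differentiableOn_cuspFunction_modularLambda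
  have h0 : Λ 0 = 0 := cuspFunction_modularLambda_zero
  -- `dslope Λ 0` is continuous on the compact disc `|q| ≤ 1/2`, hence bounded by some `M`
  have hsub : closedBall (0 : ℂ) (1 / 2) ⊆ ball 0 1 :=
    closedBall_subset_ball (by norm_num)
  have hcont : ContinuousOn (dslope Λ 0) (closedBall (0 : ℂ) (1 / 2)) := by
    refine (continuousOn_dslope (closedBall_mem_nhds (0 : ℂ) (by norm_num))).2 ⟨?_, ?_⟩
    · exact hd.continuousOn.mono hsub
    · exact hd.differentiableAt (ball_mem_nhds _ one_pos)
  obtain ⟨M, hM⟩ := (isCompact_closedBall (0 : ℂ) (1 / 2)).exists_bound_of_continuousOn hcont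
  refine IsBigO.of_bound M ?_
  rw [Filter.Eventually, atImInfty_mem]
  refine ⟨1, fun τ hτ ↦ ?_⟩
  have hq : ‖cexp (π * I * (τ : ℂ))‖ = Real.exp (-π * τ.im) := by
    rw [norm_exp]
    congr 1
    simp [mul_comm]
  have hqle : ‖cexp (π * I * (τ : ℂ))‖ ≤ 1 / 2 := by
    rw [hq]
    calc Real.exp (-π * τ.im) ≤ Real.exp (-1) := by
          apply Real.exp_le_exp.2
          nlinarith [Real.pi_gt_three, τ.im_pos]
      _ ≤ 1 / 2 := by
          rw [Real.exp_neg]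
          rw [inv_le_comm₀ (Real.exp_pos 1) (by norm_num)]
          have := Real.add_one_le_exp (1 : ℝ)
          norm_num at this ⊢
          linarith
  have hval : modularLambda τ / 16 = Λ (cexp (π * I * (τ : ℂ))) :=
    (cuspFunction_modularLambda_exp τ.im_pos).symm
  have hds : Λ (cexp (π * I * (τ : ℂ))) = cexp (π * I * (τ : ℂ)) * dslope Λ 0 (cexp (π * I * τ)) := by
    have := sub_smul_dslope Λ 0 (cexp (π * I * (τ : ℂ)))
    rw [sub_zero, h0, sub_zero, smul_eq_mul] at this
    exact this.symm
  simp only [Set.mem_setOf_eq]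
  rw [hval, hds, norm_mul, hq, Real.norm_of_nonneg (Real.exp_pos _).le, mul_comm]
  gcongr
  exact hM _ (mem_closedBall_zero_iff.2 hqle)


/-! ### The functions `h = (λ/16)^{2m} · F/Δᵐ` -/

variable {G : Subgroup SL(2, ℤ)} {m : ℕ}

/-- `Δ(γ • τ) = (cτ + d)¹² Δ(τ)` for every `γ ∈ SL(2, ℤ)`. [folklore] -/
private theorem discriminant_smul (γ : SL(2, ℤ)) (τ : ℍ) :
    ModularForm.discriminant (γ • τ) = denom γ τ ^ (12 : ℤ) * ModularForm.discriminant τ := by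
  have h := SlashInvariantForm.slash_action_eqn'' (CuspForm.discriminant)
    (γ := (γ : GL (Fin 2) ℝ)) (MonoidHom.mem_range.mpr ⟨γ, rfl⟩) τ
  simpa only [CuspForm.coe_discriminant, sl_moeb] using h

/-- **`h := (λ/16)^{2m} · F/Δᵐ` is holomorphic on `ℍ`** for any modular form `F`
(`Δ` does not vanish on `ℍ`). [cite: CalegariDimitrovTang2025, §6.3, proof of Theorem 1.0.1] -/
theorem mdifferentiable_modularLambda_pow_mul_modFun {Γ : Subgroup (GL (Fin 2) ℝ)} {k : ℤ}
    (F : ModularForm Γ k) :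
    MDiff (fun τ : ℍ ↦ (modularLambda τ / 16) ^ (2 * m) *
      (F τ / ModularForm.discriminant τ ^ m)) :=
  (mdifferentiable_modularLambda_div_sixteen.pow _).mul (modFun m F).2

/-- **`h := (λ/16)^{2m} · F/Δᵐ` is invariant under `G ⊓ Γ(2)`** for `F ∈ M_{12m}(G)`: `λ` is
`Γ(2)`-invariant and `F/Δᵐ` is `G`-invariant. [cite: CalegariDimitrovTang2025, §6.3, proof of
Theorem 1.0.1] -/
theorem modularLambda_pow_mul_modFun_smul
    (F : ModularForm (G : Subgroup (GL (Fin 2) ℝ)) (12 * (m : ℤ))) {g : SL(2, ℤ)} (hgG : g ∈ G)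
    (hg2 : g ∈ CongruenceSubgroup.Gamma 2) (τ : ℍ) :
    (modularLambda ((g • τ : ℍ) : ℂ) / 16) ^ (2 * m) *
        (F (g • τ) / ModularForm.discriminant (g • τ) ^ m) =
      (modularLambda τ / 16) ^ (2 * m) * (F τ / ModularForm.discriminant τ ^ m) := by
  rw [modularLambda_smul hg2 τ, ← modFun_apply, modFun_apply_smul_of_mem F hgG τ, modFun_apply]

/-- **Translates of `F/Δᵐ`**: `F(γτ)/Δ(γτ)ᵐ = (F|_{12m} γ)(τ)/Δ(τ)ᵐ` for every `γ ∈ SL(2, ℤ)`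
(the automorphy factors `(cτ+d)^{12m}` cancel). [cite: CalegariDimitrovTang2025, §6.3, proof of
Theorem 1.0.1] -/
theorem modFun_apply_smul_eq_slash {Γ : Subgroup (GL (Fin 2) ℝ)}
    (F : ModularForm Γ (12 * (m : ℤ))) (γ : SL(2, ℤ)) (τ : ℍ) :
    F (γ • τ) / ModularForm.discriminant (γ • τ) ^ m =
      ((F : ℍ → ℂ) ∣[(12 * (m : ℤ))] γ) τ / ModularForm.discriminant τ ^ m := by
  have hd : denom γ τ ≠ 0 := denom_ne_zero γ τ
  have hΔ : ModularForm.discriminant τ ≠ 0 := ModularForm.discriminant_ne_zero τ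
  rw [ModularForm.SL_slash_apply, discriminant_smul, mul_pow, ← zpow_natCast, ← zpow_mul,
    zpow_neg]
  field_simp

/-- **Boundedness of the translates of `h` at `i∞`**: if `γ ∈ SL(2, ℤ)` preserves `λ`, then
`τ ↦ h(γτ) = (λ(τ)/16)^{2m} (F|γ)(τ)/Δ(τ)ᵐ` is bounded as `Im τ → ∞`, because
`λ/16 = O(e^{-π Im τ})`, `F|γ = O(1)` and `1/Δ = O(e^{2π Im τ})`.
[cite: CalegariDimitrovTang2025, §6.3, proof of Theorem 1.0.1] -/
theorem isBoundedAtImInfty_modularLambda_pow_mul_modFun_smul [G.FiniteIndex]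
    (F : ModularForm (G : Subgroup (GL (Fin 2) ℝ)) (12 * (m : ℤ))) {γ : SL(2, ℤ)}
    (hγ : ∀ τ : ℍ, modularLambda ((γ • τ : ℍ) : ℂ) = modularLambda τ) :
    IsBoundedAtImInfty (fun τ : ℍ ↦ (modularLambda ((γ • τ : ℍ) : ℂ) / 16) ^ (2 * m) *
      (F (γ • τ) / ModularForm.discriminant (γ • τ) ^ m)) := by
  have h1 : (fun τ : ℍ ↦ (modularLambda ((γ • τ : ℍ) : ℂ) / 16) ^ (2 * m)) =O[atImInfty]
      fun τ : ℍ ↦ Real.exp (-π * τ.im) ^ (2 * m) := by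
    simp_rw [hγ]
    exact isBigO_modularLambda_div_sixteen_exp.pow _
  have h2 : ((F : ℍ → ℂ) ∣[(12 * (m : ℤ))] γ) =O[atImInfty] (1 : ℍ → ℝ) :=
    ModularFormClass.bdd_at_infty_slash F γ
  have h3 : (fun τ : ℍ ↦ (ModularForm.discriminant τ ^ m)⁻¹) =O[atImInfty]
      fun τ : ℍ ↦ (Real.exp (-2 * π * τ.im) ^ m)⁻¹ := by
    refine (ModularForm.exp_isBigO_discriminant.pow m).inv_rev ?_
    exact Filter.Eventually.of_forall fun τ h ↦ absurd h (pow_ne_zero _ (Real.exp_pos _).ne')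
  have h123 := h1.mul (h2.mul h3)
  have hconst : (fun τ : ℍ ↦ Real.exp (-π * τ.im) ^ (2 * m) *
      ((1 : ℍ → ℝ) τ * (Real.exp (-2 * π * τ.im) ^ m)⁻¹)) = (1 : ℍ → ℝ) := by
    funext τ
    have hne : Real.exp (-2 * π * τ.im) ^ m ≠ 0 := pow_ne_zero _ (Real.exp_pos _).ne'
    rw [Pi.one_apply, one_mul, pow_mul, ← Real.exp_nat_mul,
      show ((2 : ℕ) : ℝ) * (-π * τ.im) = -2 * π * τ.im by push_cast; ring]
    exact mul_inv_cancel₀ hne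
  rw [hconst] at h123
  change (fun τ : ℍ ↦ (modularLambda ((γ • τ : ℍ) : ℂ) / 16) ^ (2 * m) *
      (F (γ • τ) / ModularForm.discriminant (γ • τ) ^ m)) =O[atImInfty] (1 : ℍ → ℝ)
  refine (h123.congr_left fun τ ↦ ?_)
  rw [modFun_apply_smul_eq_slash]
  rfl


/-- Elements of the deck group `Λ_N` of `x = 16^{1/N} · λ^{1/N}/16^{1/N}` preserve `λ = (16^{1/N} x)^N`.
[cite: CalegariDimitrovTang2025, §5.3] -/
theorem modularLambda_smul_of_mem_modularLambdaRootDeck {N : ℕ} (hN : N ≠ 0) {γ : SL(2, ℤ)}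
    (hγ : γ ∈ modularLambdaRootDeck N) (τ : ℍ) :
    modularLambda ((γ • τ : ℍ) : ℂ) = modularLambda τ := by
  rw [← rpow_mul_modularLambdaRoot_pow hN (γ • τ), ← rpow_mul_modularLambdaRoot_pow hN τ,
    (mem_modularLambdaRootDeck_iff.1 hγ).2 τ]

/-- `T^{2N} ∈ Γ(2)`, hence so is every conjugate (`Γ(2)` is normal in `SL(2, ℤ)`). [folklore] -/
private theorem conj_T_pow_mem_Gamma_two (N : ℕ) (g : SL(2, ℤ)) :
    g * T ^ (2 * N) * g⁻¹ ∈ CongruenceSubgroup.Gamma 2 := by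
  have hT : T ^ (2 * N) ∈ CongruenceSubgroup.Gamma 2 := by
    have h := ModularGroup_T_pow_mem_Gamma 2 ((2 * N : ℕ) : ℤ) ⟨N, by push_cast; ring⟩
    rwa [zpow_natCast] at h
  exact (Gamma_normal 2).conj_mem _ hT g

/-- **CDT Theorem 1.0.1, holonomic side — the generators `F/Δᵐ` satisfy hypothesis `han` of the
dimension bound.**  Let `Φ : D(0,1) → ℂ ∖ μ_N` be a holomorphic universal covering map with
`Φ(0) = 0`, `G ≤ SL(2, ℤ)` a finite-index subgroup containing every conjugate of `T^{2N}`, and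
`F ∈ M_{12m}(G)`.  Put `h := (λ/16)^{2m} F/Δᵐ` and let `x ∈ q + q²ℚ⟦q⟧` be the formal root of
`x^N = Λ₁₆(q^N)` (`Λ₁₆` = the integral `q`-series of `λ/16` in the nome `q = e^{πiτ}`).  If a formal
power series `f ∈ ℚ⟦X⟧` satisfies `f(x) = 𝓣h`, the Taylor series of `h` in the local parameter
`q_{2N} = e^{πiτ/N}` at the cusp, then for every `0 < r < 1` the series `f(𝓣[16^{-1/N} Φ(r z)])` is
the Taylor series at `0` of a function holomorphic on a neighbourhood of the closed unit disc.
(Combine `exists_taylor_subst_eq_of_invariant_subgroup` for the finite-index subgroup `G ⊓ Γ(2)`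
with the invariance and cusp bounds for `h` above.)
[cite: CalegariDimitrovTang2025, Remark 3.0.2 and §6.3, proof of Theorem 1.0.1] -/
theorem exists_taylor_subst_eq_modFun {N : ℕ} (hN : 0 < N) {Φ : ℂ → ℂ}
    (hΦ : DifferentiableOn ℂ Φ (ball (0 : ℂ) 1))
    (hΦU : MapsTo Φ (ball (0 : ℂ) 1) {z : ℂ | z ^ N ≠ 1})
    (hcov : IsCoveringMap hΦU.restrict) (hΦ0 : Φ 0 = 0)
    [G.FiniteIndex] (hconj : ∀ g : SL(2, ℤ), g * T ^ (2 * N) * g⁻¹ ∈ G)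
    (F : ModularForm (G : Subgroup (GL (Fin 2) ℝ)) (12 * (m : ℤ)))
    {L : PowerSeries ℤ}
    (hL : qExpansion 2 (fun τ : ℍ ↦ modularLambda τ / 16) = L.map (Int.castRingHom ℂ))
    {x : PowerSeries ℚ} (hx0 : PowerSeries.constantCoeff x = 0) (hx1 : PowerSeries.coeff 1 x = 1)
    (hxN : x ^ N = PowerSeries.expand N hN.ne' (L.map (Int.castRingHom ℚ)))
    {f : PowerSeries ℚ}
    (hfH : (f.map (algebraMap ℚ ℂ)).subst (x.map (algebraMap ℚ ℂ)) =
      PowerSeries.mk fun n ↦ iteratedDeriv n (cuspFunction ((2 * N : ℕ) : ℝ)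
        (fun τ : ℍ ↦ (modularLambda τ / 16) ^ (2 * m) *
          (F τ / ModularForm.discriminant τ ^ m))) 0 / n.factorial)
    {r : ℝ} (hr0 : 0 < r) (hr1 : r < 1) :
    ∃ g : ℂ → ℂ, AnalyticOnNhd ℂ g (closedBall 0 1) ∧
      (f.map (algebraMap ℚ ℂ)).subst (PowerSeries.mk fun n ↦
          iteratedDeriv n (fun z : ℂ ↦ (((16 : ℝ) ^ (-(N : ℝ)⁻¹) : ℝ) : ℂ) * Φ ((r : ℂ) * z)) 0 /
            n.factorial) =
        PowerSeries.mk fun n ↦ iteratedDeriv n g 0 / n.factorial := by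
  haveI : (G ⊓ CongruenceSubgroup.Gamma 2).FiniteIndex := inferInstance
  have hconj' : ∀ g : SL(2, ℤ), g * T ^ (2 * N) * g⁻¹ ∈ G ⊓ CongruenceSubgroup.Gamma 2 :=
    fun g ↦ Subgroup.mem_inf.2 ⟨hconj g, conj_T_pow_mem_Gamma_two N g⟩
  have hinv : ∀ g ∈ G ⊓ CongruenceSubgroup.Gamma 2, ∀ τ : ℍ,
      (fun τ : ℍ ↦ (modularLambda τ / 16) ^ (2 * m) *
        (F τ / ModularForm.discriminant τ ^ m)) (g • τ) =
      (fun τ : ℍ ↦ (modularLambda τ / 16) ^ (2 * m) *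
        (F τ / ModularForm.discriminant τ ^ m)) τ := fun g hg τ ↦
    modularLambda_pow_mul_modFun_smul F (Subgroup.mem_inf.1 hg).1 (Subgroup.mem_inf.1 hg).2 τ
  have hbdd : ∀ γ ∈ modularLambdaRootDeck N, IsBoundedAtImInfty (fun τ : ℍ ↦
      (fun τ : ℍ ↦ (modularLambda τ / 16) ^ (2 * m) *
        (F τ / ModularForm.discriminant τ ^ m)) (γ • τ)) := fun γ hγ ↦
    isBoundedAtImInfty_modularLambda_pow_mul_modFun_smul F
      (modularLambda_smul_of_mem_modularLambdaRootDeck hN.ne' hγ)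
  exact exists_taylor_subst_eq_of_invariant_subgroup hN hΦ hΦU hcov hΦ0 hconj'
    (mdifferentiable_modularLambda_pow_mul_modFun F) hinv hbdd hL hx0 hx1 hxN hfH hr0 hr1

end UnboundedDenominators

end Literature.NumberTheory.Automorphic
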